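import Literature.Topology.FourManifolds.SurfaceGroupNielsenCoreSides
import Literature.Topology.FourManifolds.SurfaceGroupNielsenCoreSeparation2
import Literature.Topology.FourManifolds.SurfaceGroupNielsenCoreNoDoublePoint
import Literature.GroupTheory.CombinatorialGroupTheory.BinaryProductParity
import HarnessLib

/-!
# Nielsen's theorem, pillar CORE: a portal and a junction — the spur of the cut junction

Topic `Literature/Topology/FourManifolds`.  Auxiliary layer for the case P-J of the case
analysis of a double point `a < b` on the closed path of a potential-minimal configuration
(Zieschang–Vogt–Coldewey, LNM 835, proof of Thm. 5.3.2 with Lemma 5.3.4, in the lead's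
minimal-counterexample recasting): the cut `a` is interior to the kernel of an occurrence `k`
(a *portal*), the cut `b = Kstart (k₃ + 1)` is the junction of the occurrences `k₃ | k₃ + 1`
with spur `T_b = tail k₃` of length `c_b = jc k₃`.

* the tail slots `(k₃, n₃ - 1 - e)`, `e < c_b`, of the spur (`pj_isTailSlot_spur`), their
  cancelling partners `(k₃ + 1, e)` (`pj_cget_spur`), the levels of the two ends of the spur
  edge `β_e` (`pj_level_cedge`), and the fact that the spur edges cross the fixation
  (`pj_ccross_spur`);
* **the crossing cancelling edges are exactly the spur edges** `β_e`, `e < c_b`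
  (`pj_ccross_classify`: a cancelling edge crosses only inside the spur of a cut junction, and
  `a` is not a junction);
* **the crossing formal edges are edges of the portal symbol** (`pj_fcross_classify`, by
  Claim (A)); the levels of the two ends of the formal edge at `(k, q)` (`pj_level_fedge`);
* the inside occurrences are `k < j ≤ k₃` (`pj_inside_iff`);
* two list identities turning letterwise identities into `T = (V[0, s))⁻¹`, resp.
  `H[0, c) = (V[s, n))⁻¹` (`pj_eq_invRev_take`, `pj_take_eq_invRev_drop`).

The two case theorems are in `SurfaceGroupNielsenCoreCasePJ.lean` (partner of `k` inside) and
`SurfaceGroupNielsenCoreCasePJOut.lean` (partner outside).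

## References

* H. Zieschang, E. Vogt, H.-D. Coldewey, *Surfaces and Planar Discontinuous Groups*, LNM 835
  (1980), proof of Thm. 5.3.2 and Lemma 5.3.4. [ZieschangVogtColdewey1980]
-/

noncomputable section

namespace Literature.Topology.FourManifolds

open Literature.GroupTheory.CombinatorialGroupTheory CycFactors List

namespace SurfaceGroup

namespace Config

variable {g : ℕ} {φ : surfaceGen g → SurfaceGroup g}

/-! ## Two list identities -/

/-- A word `T` of length `s` whose letter at depth `e` is the inverse of `V[e]` for all `e < s`
is the inverse word of the prefix `V[0, s)`. [folklore] -/
theorem pj_eq_invRev_take {β : Type*} {T V : List (β × Bool)} {s : ℕ} (hs : s ≤ V.length)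
    (hT : T.length = s)
    (h : ∀ e, e < s → T[s - 1 - e]? = (V[e]?).map fun z => (z.1, !z.2)) :
    T = FreeGroup.invRev (V.take s) := by
  refine List.ext_getElem? fun i => ?_
  by_cases hi : i < s
  · have hl : (V.take s).length = s := by rw [List.length_take]; omega
    rw [getElem?_invRev _ (by rw [hl]; exact hi), hl, List.getElem?_take_of_lt (by omega)]
    have := h (s - 1 - i) (by omega)
    rwa [show s - 1 - (s - 1 - i) = i by omega] at this
  · rw [List.getElem?_eq_none (by omega), List.getElem?_eq_none]
    rw [FreeGroup.invRev_length, List.length_take]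
    omega

/-- A word `H` whose letter at position `e` is the inverse of `V[n - 1 - e]` for all `e < c`,
where `s + c = n = |V|`, begins with the inverse word of the suffix `V[s, n)`. [folklore] -/
theorem pj_take_eq_invRev_drop {β : Type*} {H V : List (β × Bool)} {s c : ℕ}
    (hsc : s + c = V.length) (hc : c ≤ H.length)
    (h : ∀ e, e < c → H[e]? = (V[V.length - 1 - e]?).map fun z => (z.1, !z.2)) :
    H.take c = FreeGroup.invRev (V.drop s) := by
  refine List.ext_getElem? fun i => ?_
  by_cases hi : i < c
  · have hl : (V.drop s).length = c := by rw [List.length_drop]; omega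
    rw [getElem?_invRev _ (by rw [hl]; exact hi), hl, List.getElem?_take_of_lt hi, h i hi,
      List.getElem?_drop]
    congr 2
    omega
  · rw [List.getElem?_eq_none (by rw [List.length_take]; omega), List.getElem?_eq_none]
    rw [FreeGroup.invRev_length, List.length_drop]
    omega

/-! ## The spur of the cut junction -/

/-- **The slots of the spur**: for `e < c_b = jc k₃` the slot `(k₃, n₃ - 1 - e)` (at depth `e`)
is a tail slot of `k₃`. [cite: ZieschangVogtColdewey1980, proof of Thm. 5.3.2] -/
theorem pj_isTailSlot_spur (κ : Config φ) {k₃ : ℕ} (hk₃ : k₃ < κ.w.length) {e : ℕ}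
    (he : e < jc κ.U k₃) : IsTailSlot κ.U (k₃, (fac κ.U k₃).length - 1 - e) := by
  have hk₃U : k₃ < κ.U.length := by rw [length_U]; exact hk₃
  have h1 : jc κ.U k₃ ≤ (fac κ.U k₃).length := jc_le_length κ.U k₃
  exact ⟨⟨hk₃U, by dsimp only; omega⟩, by dsimp only; omega⟩

/-- **The cancelling partner of a spur slot**: the tail slot of `k₃` at depth `e` cancels
against the head slot `(k₃ + 1, e)` (for `k₃ + 1 < m`). [cite: ZieschangVogtColdewey1980, proof of Thm. 5.3.2] -/
theorem pj_cget_spur (κ : Config φ) {k₃ : ℕ} (hk₄ : k₃ + 1 < κ.w.length) {e : ℕ}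
    (he : e < jc κ.U k₃) : cget κ.U (k₃, (fac κ.U k₃).length - 1 - e) = (k₃ + 1, e) := by
  have ht := κ.pj_isTailSlot_spur (by omega) he
  rw [ht.cget_eq]
  have hU : k₃ + 1 < κ.U.length := by rw [length_U]; exact hk₄
  have h1 : jc κ.U k₃ ≤ (fac κ.U k₃).length := jc_le_length κ.U k₃
  exact Prod.ext (Nat.mod_eq_of_lt hU) (by dsimp only; omega)

/-- **The levels of a formal edge of `k`**: both ends of the formal edge at `(k, q)` have the
level `min q (n - 1 - q)`. [cite: ZieschangVogtColdewey1980, proof of Thm. 5.3.2] -/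
theorem pj_level_fedge (κ : Config φ) {k q e : ℕ} (hk : k < κ.w.length)
    (he : min q ((fac κ.U k).length - 1 - q) = e) :
    ∀ ρ ∈ (fedge κ.U κ.bar (k, q)).2, level κ.U ρ = e := by
  have hkU : k < κ.U.length := by rw [length_U]; exact hk
  have hnbar := κ.isPairing_bar.length_fac_bar hkU
  intro ρ hρ
  rcases mem_fedge.1 hρ with rfl | rfl
  · exact he
  · simp only [level, fpartner, hnbar]
    omega

section Min

variable (κ : Config φ) (hg : 1 ≤ g) (hI : Indecomposable φ) (hM : MarkedNontrivial φ)
  (hmin : κ.IsMin)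
include hg hI hM hmin

/-- **The levels of a spur edge**: both ends of the cancelling edge at the spur slot of depth
`e` have level `e`. [cite: ZieschangVogtColdewey1980, proof of Thm. 5.3.2] -/
theorem pj_level_cedge {k₃ : ℕ} (hk₃ : k₃ < κ.w.length) {e : ℕ} (he : e < jc κ.U k₃) :
    ∀ ρ ∈ (cedge κ.U (k₃, (fac κ.U k₃).length - 1 - e)).2, level κ.U ρ = e := by
  have hN := κ.cycNielsen_U hg hI hM hmin
  have ht := κ.pj_isTailSlot_spur hk₃ he
  have h1 : jc κ.U k₃ ≤ (fac κ.U k₃).length := jc_le_length κ.U k₃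
  have hl : level κ.U (k₃, (fac κ.U k₃).length - 1 - e) = e := by
    rw [ht.level_eq hN]
    dsimp only
    omega
  intro ρ hρ
  rcases mem_cedge.1 hρ with rfl | rfl
  · exact hl
  · rw [ht.level_cget hN, hl]

/-- **The spur edges cross the fixation**: for the cut junction `b = Kstart (k₃ + 1)` the
cancelling edge at every spur slot of `k₃` is a crossing edge.
[cite: ZieschangVogtColdewey1980, Lemma 5.3.4] -/
theorem pj_ccross_spur {a b : ℕ} (hab : a < b) (hbℓ : b < (closedPath κ.U).length)
    (hsep : ∀ j, ¬ (κ.PortalAt a j ∧ κ.PortalAt b j)) {k₃ : ℕ} (hk₄ : k₃ + 1 < κ.w.length)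
    (hb : κ.Kstart (k₃ + 1) = b) {e : ℕ} (he : e < jc κ.U k₃) :
    κ.CCross a b (k₃, (fac κ.U k₃).length - 1 - e) := by
  have ht := κ.pj_isTailSlot_spur (by omega) he
  rw [κ.ccross_iff_of_isTailSlot hg hI hM hmin hab hbℓ hsep ht]
  right
  dsimp only
  rw [Nat.mod_eq_of_lt hk₄, hb]

/-- **The crossing cancelling edges are the spur edges**: if `a` is not a junction and
`b = Kstart (k₃ + 1)`, every crossing cancelling edge is the edge at a spur slot
`(k₃, n₃ - 1 - e)`, `e < jc k₃`, where `e` is the level of its ends.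
[cite: ZieschangVogtColdewey1980, Lemma 5.3.4] -/
theorem pj_ccross_classify {a b : ℕ} (hab : a < b) (hbℓ : b < (closedPath κ.U).length)
    (hsep : ∀ j, ¬ (κ.PortalAt a j ∧ κ.PortalAt b j)) (hJa : ¬ κ.IsJunction a)
    {k₃ : ℕ} (hk₄ : k₃ + 1 < κ.w.length) (hb : κ.Kstart (k₃ + 1) = b)
    {σ : ℕ × ℕ} (hσ : IsSlot κ.U σ) (hkσ : ¬ IsKernelSlot κ.U σ) (hc : κ.CCross a b σ) :
    ∃ e, e < jc κ.U k₃ ∧ level κ.U σ = e ∧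
      cedge κ.U σ = cedge κ.U (k₃, (fac κ.U k₃).length - 1 - e) := by
  have hN := κ.cycNielsen_U hg hI hM hmin
  have hU := κ.U_ne_nil hg
  have hm : 0 < κ.w.length := by omega
  rcases hσ.head_or_tail hkσ with hh | ht
  · -- a head slot: of the occurrence `k₃ + 1`
    have hσm : σ.1 < κ.w.length := by rw [← length_U]; exact hh.1.1
    rcases (κ.ccross_iff_of_isHeadSlot hg hI hM hmin hab hbℓ hsep hh).1 hc with h | h
    · exact (hJa ⟨σ.1, hσm, h⟩).elim
    · have hj : σ.1 = k₃ + 1 := κ.Kstart_injective hg hI hM hmin (h.trans hb.symm)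
      have hp : σ.2 < jc κ.U k₃ := by
        have := hh.2
        rw [hj, jc_cpred_succ] at this
        exact this
      refine ⟨σ.2, hp, hh.level_eq hN, ?_⟩
      have ht' := κ.pj_isTailSlot_spur (by omega) hp
      have hcg := κ.pj_cget_spur hk₄ hp
      have e : σ = cget κ.U (k₃, (fac κ.U k₃).length - 1 - σ.2) := by
        rw [hcg]
        exact Prod.ext hj rfl
      calc cedge κ.U σ = cedge κ.U (cget κ.U (k₃, (fac κ.U k₃).length - 1 - σ.2)) :=
            congrArg _ e
        _ = cedge κ.U (k₃, (fac κ.U k₃).length - 1 - σ.2) :=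
            cedge_cget hN hU ht'.1 fun hk => hk.not_isTailSlot ht'
  · -- a tail slot: of the occurrence `k₃`
    rcases (κ.ccross_iff_of_isTailSlot hg hI hM hmin hab hbℓ hsep ht).1 hc with h | h
    · exact (hJa ⟨_, Nat.mod_lt _ hm, h⟩).elim
    · have hσm : σ.1 < κ.w.length := by rw [← length_U]; exact ht.1.1
      have hj1 : (σ.1 + 1) % κ.w.length = k₃ + 1 :=
        κ.Kstart_injective hg hI hM hmin (h.trans hb.symm)
      have hj : σ.1 = k₃ := by
        rcases Nat.lt_or_ge (σ.1 + 1) κ.w.length with h1 | h1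
        · rw [Nat.mod_eq_of_lt h1] at hj1
          omega
        · have e : σ.1 + 1 = κ.w.length := by omega
          rw [e, Nat.mod_self] at hj1
          omega
      have h2 := ht.2
      have h3 := ht.1.2
      rw [hj] at h2 h3
      refine ⟨(fac κ.U k₃).length - 1 - σ.2, by omega, ?_, ?_⟩
      · rw [ht.level_eq hN, hj]
      · congr 1
        exact Prod.ext hj (by dsimp only; omega)

/-- **The crossing formal edges belong to the portal symbol**: for the portal `k` at `a` and a
junction at `b`, every crossing formal edge is the (crossing) formal edge at a slot `(k, q)` of
`k` (Claim (A) for the other symbols; the edge at `(k̄, q)` is the edge at `(k, n - 1 - q)`).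
[cite: ZieschangVogtColdewey1980, Lemma 5.3.4] -/
theorem pj_fcross_classify {a b : ℕ}
    (hP2 : ∀ σ : ℕ × ℕ, IsKernelSlot κ.U σ → σ.1 < κ.w.length →
      ((a ≤ kpos κ.U σ ∧ kpos κ.U σ < b) ↔
        (a ≤ kpos κ.U (chainEnd κ.U κ.bar σ) ∧ kpos κ.U (chainEnd κ.U κ.bar σ) < b)))
    {k : ℕ} (hk : k < κ.w.length) (hpk : κ.PortalAt a k) (hJb : κ.IsJunction b)
    {σ : ℕ × ℕ} (hσ : IsSlot κ.U σ) (hc : κ.FCross a b σ) :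
    ∃ q, q < (fac κ.U k).length ∧ κ.FCross a b (k, q) ∧
      fedge κ.U κ.bar σ = fedge κ.U κ.bar (k, q) := by
  have hkU : k < κ.U.length := by rw [length_U]; exact hk
  have hb := κ.isPairing_bar
  obtain ⟨j, q⟩ := σ
  by_cases h1 : j = k
  · subst h1
    exact ⟨q, hσ.2, hc, rfl⟩
  by_cases h2 : j = κ.bar k
  · subst h2
    have hq : q < (fac κ.U k).length := by
      have := hσ.2
      simp only [hb.length_fac_bar hkU] at this
      exact this
    refine ⟨(fac κ.U k).length - 1 - q, by omega, (κ.fcross_bar_iff hk hq).1 hc, ?_⟩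
    have hs' : IsSlot κ.U (k, (fac κ.U k).length - 1 - q) := ⟨hkU, by dsimp only; omega⟩
    have e : fpartner κ.U κ.bar (k, (fac κ.U k).length - 1 - q) = (κ.bar k, q) :=
      Prod.ext rfl (by dsimp only [fpartner]; omega)
    rw [← e, fedge_fpartner hb hs']
  · exfalso
    have hjU : j < κ.U.length := hσ.1
    refine κ.not_fcross_of_not_portalAt hg hI hM hmin hP2 hσ ?_ ?_ ?_ ?_ hc
    · exact fun h => h1 (κ.portalAt_unique h hpk)
    · exact κ.not_portalAt_of_isJunction hJb _
    · intro h
      have := κ.portalAt_unique h hpk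
      exact h2 (by rw [← hb.bar_bar j hjU, this])
    · exact κ.not_portalAt_of_isJunction hJb _

/-- **The inside occurrences of a P-J double point**: for the portal `k` at `a` and the
junction `b = Kstart (k₃ + 1)`, occurrence `j` is inside iff `k < j ≤ k₃`.
[cite: ZieschangVogtColdewey1980, proof of Thm. 5.3.2] -/
theorem pj_inside_iff {a b k k₃ : ℕ} (hpk : κ.PortalAt a k) (hb : κ.Kstart (k₃ + 1) = b)
    (j : ℕ) : κ.Inside a b j ↔ k < j ∧ j < k₃ + 1 := by
  unfold Inside
  rw [← hb, ← Kstart_succ, κ.Kstart_le_Kstart_iff hg hI hM hmin]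
  constructor
  · rintro ⟨h1, h2⟩
    exact ⟨(κ.Kstart_lt_Kstart_iff hg hI hM hmin).1 (hpk.1.trans_le h1), by omega⟩
  · rintro ⟨h1, h2⟩
    have := κ.Kend_le_Kstart_of_lt h1
    have := hpk.2
    exact ⟨by omega, by omega⟩

end Min

end Config

end SurfaceGroup

end Literature.Topology.FourManifolds

end
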